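import Mathlib
import HarnessLib
import Literature.Analysis.PDE.DivFormLiouville
import Literature.Analysis.FunctionSpaces.SmoothCutoff
import Summits.NavierStokesRegularity.NavierStokesRegularity.Theorems.PoloidalWindowDoorPoloidalWindowRigidityDivFormCaccioppoli
import Summits.NavierStokesRegularity.NavierStokesRegularity.Theorems.PoloidalWindowDoorPoloidalWindowRigidityDivFormCaccioppoliPowers

/-!
# Route `PoloidalWindowDoor`, crux K2 (stmt-NavierStokesRegularity-19708) — task H5, step M3a (part 1): cutoffs between
# concentric balls and the DIRICHLET ENERGY of `χ·u^{p/2}` for `div(a∇u) = 0` (Moser 1961 §4; Gilbarg–Trudinger §8.6)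

Setting = the rendering of the named fact `Literature.Analysis.PDE.divFormLiouville` (coefficients `a` measurable,
symmetric, `λ|ξ|² ≤ ξ·aξ`, `|aᵢⱼ| ≤ Λ`; `u ∈ C¹(ℝⁿ)` an entire weak solution with `u ≥ 1`), dimension `n ≥ 3`,
Sobolev exponent `κ = n/(n−2)`.

* `exists_cutoff_two_radii` — a `C¹` cutoff `χ`, `= 1` on `B(x₀,r)`, `= 0` off `B(x₀,R)`, `‖Dχ‖ ≤ C₁/(R − r)`
  (from the tree's `SmoothCutoff.exists_smooth_cutoff`);
* `integral_sq_fderiv_rpow_le` — Caccioppoli for `w = u^{p/2}`, `p ∉ {0,1}`: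
  `∫ χ² ‖Dw‖² ≤ (p/(p−1))² (nΛ/λ) ∫ u^p ‖Dχ‖²` (from K2-p3's `caccioppoli_rpow`, `β = p − 1`);
* `integral_sq_fderiv_cutoff_rpow_le` — the energy of `g = χ·u^{p/2}` for a cutoff between `B(x₀,r) ⊂ B(x₀,R)`:
  `∫ ‖Dg‖² ≤ 2((p/(p−1))² nΛ/λ + 1)(C₁/(R−r))² ∫_{B(x₀,R)} u^p`.
The sequel `…DivFormReverseHolder` feeds this into the Gagliardo–Nirenberg–Sobolev inequality (the reverse Hölder step
that Moser iterates); seat nsreg-p6 g7, helper of the crux (the fact's claim #1 is K2-p3's).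

WHAT THIS IS NOT: not the Harnack inequality and not the Liouville theorem; nothing NS-specific.
-/

noncomputable section

open MeasureTheory Set Function Filter Topology Metric
open scoped Matrix ENNReal NNReal

-- the summit and its single sub-problem share the name (CONVENTIONS §1), as in every Theorems file
set_option linter.dupNamespace false

namespace Summit.NavierStokesRegularity.NavierStokesRegularity.Theorems.PoloidalWindowDoorPoloidalWindowRigidityDivFormCutoffEnergy

open Summit.NavierStokesRegularity.NavierStokesRegularity.Theorems.PoloidalWindowDoorPoloidalWindowRigidityDivFormCaccioppoli
open Summit.NavierStokesRegularity.NavierStokesRegularity.Theorems.PoloidalWindowDoorPoloidalWindowRigidityDivFormCaccioppoliPowers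

variable {n : ℕ}

/-! ### A `C¹` cutoff between two concentric balls -/

/-- A `C¹` cutoff between the balls `B(x₀,r) ⊂ B(x₀,R)`: `χ = 1` on the small ball, `χ = 0` off the large one,
`0 ≤ χ ≤ 1`, `‖Dχ‖ ≤ C₁/(R−r)` with `C₁` depending only on the dimension. -/
theorem exists_cutoff_two_radii (n : ℕ) : ∃ C₁ : ℝ, 0 ≤ C₁ ∧ ∀ (x₀ : EuclideanSpace ℝ (Fin n)) (r R : ℝ),
    0 < r → r < R → ∃ χ : EuclideanSpace ℝ (Fin n) → ℝ, ContDiff ℝ 1 χ ∧ HasCompactSupport χ ∧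
      (∀ x, 0 ≤ χ x ∧ χ x ≤ 1) ∧ (∀ x ∈ ball x₀ r, χ x = 1) ∧ (∀ x, x ∉ ball x₀ R → χ x = 0) ∧
      ∀ x, ‖fderiv ℝ χ x‖ ≤ C₁ / (R - r) := by
  obtain ⟨C, hC0, hC⟩ :=
    Literature.Analysis.FunctionSpaces.exists_smooth_cutoff (volume : Measure (EuclideanSpace ℝ (Fin n)))
  refine ⟨2 * C, by positivity, fun x₀ r R hr hrR => ?_⟩
  set δ := (R - r) / 2 with hδ
  have hδpos : 0 < δ := by rw [hδ]; linarith
  obtain ⟨χ, hχs, hχ01, hχ1, hχ0, hχD⟩ := hC (ball x₀ (r + δ)) measurableSet_ball δ hδpos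
  have hzero : ∀ x, x ∉ ball x₀ R → χ x = 0 := by
    intro x hx
    refine hχ0 x (Metric.ball_disjoint_ball ?_)
    rw [mem_ball, not_lt] at hx
    linarith
  refine ⟨χ, hχs.of_le (by norm_cast), ?_, hχ01, fun x hx => hχ1 x ?_, hzero, fun x => (hχD x).trans_eq ?_⟩
  · refine HasCompactSupport.intro (isCompact_closedBall x₀ R) fun x hx => hzero x fun hx' => hx ?_
    exact ball_subset_closedBall hx'
  · refine Metric.ball_subset_ball' ?_
    rw [mem_ball] at hx
    linarith
  · rw [hδ]; field_simp

/-- The derivative of a nonnegative cutoff vanishes wherever the cutoff does. -/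
theorem fderiv_eq_zero_of_nonneg_of_eq_zero {χ : EuclideanSpace ℝ (Fin n) → ℝ} (hχ0 : ∀ y, 0 ≤ χ y)
    {x : EuclideanSpace ℝ (Fin n)} (hx : χ x = 0) : fderiv ℝ χ x = 0 := by
  have h : IsLocalMin χ x := Filter.Eventually.of_forall fun y => by rw [hx]; exact hχ0 y
  exact h.fderiv_eq_zero

variable {a : EuclideanSpace ℝ (Fin n) → Matrix (Fin n) (Fin n) ℝ} {lam Λ : ℝ} {u : EuclideanSpace ℝ (Fin n) → ℝ}

/-! ### Caccioppoli for `w = u^{p/2}` -/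

/-- The gradient of `w = u^{p/2}`: `Dw = (p/2) u^{p/2−1} Du` (`u > 0`). -/
theorem fderiv_rpow_half (hu : ContDiff ℝ 1 u) (hupos : ∀ y, 0 < u y) (p : ℝ) (y : EuclideanSpace ℝ (Fin n)) :
    fderiv ℝ (fun y => u y ^ (p / 2)) y = (p / 2 * u y ^ (p / 2 - 1)) • fderiv ℝ u y :=
  (((hu.differentiable one_ne_zero) y).hasFDerivAt.rpow_const (p := p / 2) (Or.inl (hupos y).ne')).fderiv

/-- **Caccioppoli for `w = u^{p/2}`** (`p ∉ {0,1}`): `∫ χ² ‖Dw‖² ≤ (p/(p−1))² (nΛ/λ) ∫ u^p ‖Dχ‖²`. -/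
theorem integral_sq_fderiv_rpow_le (hsymm : ∀ y, (a y).IsSymm) (hlam : 0 < lam)
    (hmeas : ∀ i j, Measurable fun y => a y i j)
    (hell : ∀ y (ξ : Fin n → ℝ), lam * (ξ ⬝ᵥ ξ) ≤ ξ ⬝ᵥ (a y *ᵥ ξ)) (hbd : ∀ y i j, |a y i j| ≤ Λ)
    (hu : ContDiff ℝ 1 u) (hu1 : ∀ y, 1 ≤ u y)
    (hweak : ∀ η : EuclideanSpace ℝ (Fin n) → ℝ, ContDiff ℝ 1 η → HasCompactSupport η →
      ∫ y, ∑ i, ∑ j, a y i j * fderiv ℝ u y (EuclideanSpace.single i 1) *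
        fderiv ℝ η y (EuclideanSpace.single j 1) = 0)
    {p : ℝ} (hp0 : p ≠ 0) (hp1 : p ≠ 1) {χ : EuclideanSpace ℝ (Fin n) → ℝ} (hχ : ContDiff ℝ 1 χ)
    (hχc : HasCompactSupport χ) :
    ∫ y, χ y ^ 2 * ‖fderiv ℝ (fun y => u y ^ (p / 2)) y‖ ^ 2 ≤
      (p / (p - 1)) ^ 2 * (n * Λ / lam) * ∫ y, u y ^ p * ‖fderiv ℝ χ y‖ ^ 2 := by
  have hupos : ∀ y, 0 < u y := fun y => lt_of_lt_of_le one_pos (hu1 y)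
  have hβ : p - 1 ≠ 0 := sub_ne_zero.2 hp1
  have hc := caccioppoli_rpow hsymm hlam hmeas hell hbd hu hu1 hweak hβ hχ hχc
  set Du : EuclideanSpace ℝ (Fin n) → Fin n → ℝ := fun y i => fderiv ℝ u y (EuclideanSpace.single i 1) with hDu
  set Dχ : EuclideanSpace ℝ (Fin n) → Fin n → ℝ := fun y j => fderiv ℝ χ y (EuclideanSpace.single j 1) with hDχ
  have hcu := continuous_fderiv_single hu
  have hcχ := continuous_fderiv_single hχ
  -- continuity of the real powers of `u`
  have hupow : ∀ q : ℝ, Continuous fun y => u y ^ q := fun q =>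
    hu.continuous.rpow_const fun y => Or.inl (hupos y).ne'
  -- pointwise: `χ² ‖Dw‖² = (p²/4) χ² u^{p-2} ‖Du‖² ≤ (p²/(4λ)) χ² u^{(p-1)-1} Du·aDu`
  have hw2 : ∀ y, ‖fderiv ℝ (fun y => u y ^ (p / 2)) y‖ ^ 2 = (p / 2) ^ 2 * u y ^ (p - 2) * ∑ i, Du y i ^ 2 := by
    intro y
    rw [fderiv_rpow_half hu hupos p y, norm_smul, mul_pow, Real.norm_eq_abs, sq_abs, hDu]
    simp only [sum_fderiv_single_sq]
    have h2 : (u y ^ (p / 2 - 1)) ^ 2 = u y ^ (p - 2) := by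
      rw [← Real.rpow_natCast, ← Real.rpow_mul (hupos y).le]; congr 1; push_cast; ring
    rw [mul_pow, h2]
  have hlow : ∀ y, χ y ^ 2 * ‖fderiv ℝ (fun y => u y ^ (p / 2)) y‖ ^ 2 ≤
      (p / 2) ^ 2 / lam * (χ y ^ 2 * u y ^ (p - 1 - 1) * (Du y ⬝ᵥ (a y *ᵥ Du y))) := by
    intro y
    rw [hw2 y, show p - 1 - 1 = p - 2 by ring]
    have hq := quadForm_lower hell y (Du y)
    have h0 : 0 ≤ χ y ^ 2 * u y ^ (p - 2) := mul_nonneg (sq_nonneg _) (Real.rpow_nonneg (hupos y).le _)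
    have h1 : χ y ^ 2 * u y ^ (p - 2) * (lam * ∑ i, Du y i ^ 2) ≤
        χ y ^ 2 * u y ^ (p - 2) * (Du y ⬝ᵥ (a y *ᵥ Du y)) := mul_le_mul_of_nonneg_left hq h0
    have hlam' : (p / 2) ^ 2 / lam * (χ y ^ 2 * u y ^ (p - 2) * (Du y ⬝ᵥ (a y *ᵥ Du y))) =
        (lam)⁻¹ * ((p / 2) ^ 2 * (χ y ^ 2 * u y ^ (p - 2) * (Du y ⬝ᵥ (a y *ᵥ Du y)))) := by ring
    rw [hlam']
    rw [le_inv_mul_iff₀ hlam]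
    nlinarith [sq_nonneg (p / 2)]
  -- pointwise: `u^p Dχ·aDχ ≤ nΛ u^p ‖Dχ‖²`
  have hup : ∀ y, u y ^ (p - 1 + 1) * (Dχ y ⬝ᵥ (a y *ᵥ Dχ y)) ≤ n * Λ * (u y ^ p * ‖fderiv ℝ χ y‖ ^ 2) := by
    intro y
    rw [show p - 1 + 1 = p by ring, ← sum_fderiv_single_sq χ y]
    have hq := quadForm_upper hbd y (Dχ y)
    have h0 : 0 ≤ u y ^ p := Real.rpow_nonneg (hupos y).le _
    calc u y ^ p * (Dχ y ⬝ᵥ (a y *ᵥ Dχ y)) ≤ u y ^ p * (n * Λ * ∑ i, Dχ y i ^ 2) :=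
          mul_le_mul_of_nonneg_left hq h0
      _ = n * Λ * (u y ^ p * ∑ j, fderiv ℝ χ y (EuclideanSpace.single j 1) ^ 2) := by rw [hDχ]; ring
  -- integrability
  have hχ2c : HasCompactSupport fun y => χ y ^ 2 := hχc.comp_left (g := fun s : ℝ => s ^ 2) (by simp)
  have hwd : ContDiff ℝ 1 fun y => u y ^ (p / 2) := hu.rpow_const_of_ne fun y => (hupos y).ne'
  have hI1 : Integrable fun y => χ y ^ 2 * ‖fderiv ℝ (fun y => u y ^ (p / 2)) y‖ ^ 2 := by
    have hcw : Continuous fun y => ‖fderiv ℝ (fun y => u y ^ (p / 2)) y‖ ^ 2 :=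
      ((hwd.continuous_fderiv one_ne_zero).norm).pow 2
    have hc2 : HasCompactSupport fun y => χ y ^ 2 * ‖fderiv ℝ (fun y => u y ^ (p / 2)) y‖ ^ 2 :=
      hχ2c.mul_right
    exact ((hχ.continuous.pow 2).mul hcw).integrable_of_hasCompactSupport hc2
  have hI2 : Integrable fun y => χ y ^ 2 * u y ^ (p - 1 - 1) * (Du y ⬝ᵥ (a y *ᵥ Du y)) := by
    have hc2 : HasCompactSupport fun y => χ y ^ 2 * u y ^ (p - 1 - 1) := hχ2c.mul_right
    have h := integrable_mul_of_le_continuous (n := n) (m := fun y => Du y ⬝ᵥ (a y *ᵥ Du y))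
      (M := fun y => n * Λ * (∑ i, Du y i ^ 2 + ∑ j, Du y j ^ 2) / 2) (φ := fun y => χ y ^ 2 * u y ^ (p - 1 - 1))
      (measurable_dotProduct_mulVec hmeas hcu hcu) (by simp only [hDu]; fun_prop)
      (fun y => abs_dotProduct_mulVec_le hsymm hlam hell hbd y _ _) ((hχ.continuous.pow 2).mul (hupow _)) hc2
    exact h.congr (Eventually.of_forall fun y => by ring)
  have hDχc : HasCompactSupport fun y => ‖fderiv ℝ χ y‖ ^ 2 :=
    (hχc.fderiv (𝕜 := ℝ)).norm.comp_left (g := fun s : ℝ => s ^ 2) (by simp)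
  have hc3 : HasCompactSupport fun y => u y ^ p * ‖fderiv ℝ χ y‖ ^ 2 := hDχc.mul_left
  have hI3 : Integrable fun y => u y ^ p * ‖fderiv ℝ χ y‖ ^ 2 :=
    ((hupow p).mul (((hχ.continuous_fderiv one_ne_zero).norm).pow 2)).integrable_of_hasCompactSupport hc3
  have hI4 : Integrable fun y => u y ^ (p - 1 + 1) * (Dχ y ⬝ᵥ (a y *ᵥ Dχ y)) := by
    have hM : Integrable fun y => n * Λ * (u y ^ p * ‖fderiv ℝ χ y‖ ^ 2) := hI3.const_mul _
    refine hM.mono' (((hupow _).aestronglyMeasurable).mul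
      (measurable_dotProduct_mulVec hmeas hcχ hcχ).aestronglyMeasurable) (Eventually.of_forall fun y => ?_)
    have hq0 : 0 ≤ Dχ y ⬝ᵥ (a y *ᵥ Dχ y) :=
      (mul_nonneg hlam.le (Finset.sum_nonneg fun i _ => sq_nonneg (Dχ y i))).trans (quadForm_lower hell y _)
    rw [Real.norm_eq_abs, abs_of_nonneg (mul_nonneg (Real.rpow_nonneg (hupos y).le _) hq0)]
    exact hup y
  -- assemble
  have hΛ0 : 0 ≤ n * Λ := by
    rcases Nat.eq_zero_or_pos n with hn | hn
    · simp [hn]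
    · exact mul_nonneg (Nat.cast_nonneg _) ((abs_nonneg _).trans (hbd 0 ⟨0, hn⟩ ⟨0, hn⟩))
  calc ∫ y, χ y ^ 2 * ‖fderiv ℝ (fun y => u y ^ (p / 2)) y‖ ^ 2
      ≤ ∫ y, (p / 2) ^ 2 / lam * (χ y ^ 2 * u y ^ (p - 1 - 1) * (Du y ⬝ᵥ (a y *ᵥ Du y))) :=
        integral_mono hI1 (hI2.const_mul _) hlow
    _ = (p / 2) ^ 2 / lam * ∫ y, χ y ^ 2 * u y ^ (p - 1 - 1) * (Du y ⬝ᵥ (a y *ᵥ Du y)) := integral_const_mul _ _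
    _ ≤ (p / 2) ^ 2 / lam * (4 / (p - 1) ^ 2 * ∫ y, u y ^ (p - 1 + 1) * (Dχ y ⬝ᵥ (a y *ᵥ Dχ y))) :=
        mul_le_mul_of_nonneg_left hc (by positivity)
    _ ≤ (p / 2) ^ 2 / lam * (4 / (p - 1) ^ 2 * ∫ y, n * Λ * (u y ^ p * ‖fderiv ℝ χ y‖ ^ 2)) :=
        mul_le_mul_of_nonneg_left (mul_le_mul_of_nonneg_left (integral_mono hI4 (hI3.const_mul _) hup)
          (by positivity)) (by positivity)
    _ = (p / (p - 1)) ^ 2 * (n * Λ / lam) * ∫ y, u y ^ p * ‖fderiv ℝ χ y‖ ^ 2 := by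
        rw [integral_const_mul]
        field_simp
        ring


/-! ### The Dirichlet energy of `χ u^{p/2}` -/

/-- **Energy bound for `g = χ·u^{p/2}`**: with a cutoff `χ` (`0 ≤ χ ≤ 1`, `= 0` off `B(x₀,R)`, `‖Dχ‖ ≤ C₁/(R−r)`),
`∫ ‖Dg‖² ≤ 2 ((p/(p−1))² nΛ/λ + 1) (C₁/(R−r))² ∫_{B(x₀,R)} u^p`. -/
theorem integral_sq_fderiv_cutoff_rpow_le (hsymm : ∀ y, (a y).IsSymm) (hlam : 0 < lam)
    (hmeas : ∀ i j, Measurable fun y => a y i j)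
    (hell : ∀ y (ξ : Fin n → ℝ), lam * (ξ ⬝ᵥ ξ) ≤ ξ ⬝ᵥ (a y *ᵥ ξ)) (hbd : ∀ y i j, |a y i j| ≤ Λ)
    (hu : ContDiff ℝ 1 u) (hu1 : ∀ y, 1 ≤ u y)
    (hweak : ∀ η : EuclideanSpace ℝ (Fin n) → ℝ, ContDiff ℝ 1 η → HasCompactSupport η →
      ∫ y, ∑ i, ∑ j, a y i j * fderiv ℝ u y (EuclideanSpace.single i 1) *
        fderiv ℝ η y (EuclideanSpace.single j 1) = 0)
    {p : ℝ} (hp0 : p ≠ 0) (hp1 : p ≠ 1) {χ : EuclideanSpace ℝ (Fin n) → ℝ} (hχ : ContDiff ℝ 1 χ)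
    (hχc : HasCompactSupport χ) (hχ01 : ∀ x, 0 ≤ χ x ∧ χ x ≤ 1) {x₀ : EuclideanSpace ℝ (Fin n)} {r R C₁ : ℝ}
    (hχ0 : ∀ x, x ∉ ball x₀ R → χ x = 0) (hχD : ∀ x, ‖fderiv ℝ χ x‖ ≤ C₁ / (R - r)) :
    ∫ y, ‖fderiv ℝ (fun y => χ y * u y ^ (p / 2)) y‖ ^ 2 ≤
      2 * ((p / (p - 1)) ^ 2 * (n * Λ / lam) + 1) * (C₁ / (R - r)) ^ 2 * ∫ y in ball x₀ R, u y ^ p := by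
  have hupos : ∀ y, 0 < u y := fun y => lt_of_lt_of_le one_pos (hu1 y)
  have hupow : ∀ q : ℝ, Continuous fun y => u y ^ q := fun q =>
    hu.continuous.rpow_const fun y => Or.inl (hupos y).ne'
  have hwd : ContDiff ℝ 1 fun y => u y ^ (p / 2) := hu.rpow_const_of_ne fun y => (hupos y).ne'
  set w : EuclideanSpace ℝ (Fin n) → ℝ := fun y => u y ^ (p / 2) with hw
  have hC₁ : 0 ≤ C₁ / (R - r) := (norm_nonneg _).trans (hχD x₀)
  -- product rule and the pointwise bound `‖Dg‖² ≤ 2χ²‖Dw‖² + 2w²‖Dχ‖²`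
  have hprod : ∀ y, fderiv ℝ (fun y => χ y * w y) y = χ y • fderiv ℝ w y + w y • fderiv ℝ χ y := by
    intro y
    have hχd := ((hχ.differentiable one_ne_zero) y).hasFDerivAt
    have hwd' := ((hwd.differentiable one_ne_zero) y).hasFDerivAt
    rw [show (fun y => χ y * w y) = χ * w from rfl, (hχd.mul hwd').fderiv]
  have hpt : ∀ y, ‖fderiv ℝ (fun y => χ y * w y) y‖ ^ 2 ≤
      2 * (χ y ^ 2 * ‖fderiv ℝ w y‖ ^ 2) + 2 * (u y ^ p * ‖fderiv ℝ χ y‖ ^ 2) := by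
    intro y
    rw [hprod y]
    have h1 : ‖χ y • fderiv ℝ w y + w y • fderiv ℝ χ y‖ ≤ |χ y| * ‖fderiv ℝ w y‖ + |w y| * ‖fderiv ℝ χ y‖ := by
      refine (norm_add_le _ _).trans ?_
      rw [norm_smul, norm_smul, Real.norm_eq_abs, Real.norm_eq_abs]
    have hw2 : |w y| ^ 2 = u y ^ p := by
      rw [sq_abs, hw]
      simp only
      rw [← Real.rpow_natCast, ← Real.rpow_mul (hupos y).le]; congr 1; push_cast; ring
    have h0 : 0 ≤ |χ y| * ‖fderiv ℝ w y‖ + |w y| * ‖fderiv ℝ χ y‖ := by positivity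
    calc ‖χ y • fderiv ℝ w y + w y • fderiv ℝ χ y‖ ^ 2
        ≤ (|χ y| * ‖fderiv ℝ w y‖ + |w y| * ‖fderiv ℝ χ y‖) ^ 2 := pow_le_pow_left₀ (norm_nonneg _) h1 2
      _ ≤ 2 * (|χ y| ^ 2 * ‖fderiv ℝ w y‖ ^ 2) + 2 * (|w y| ^ 2 * ‖fderiv ℝ χ y‖ ^ 2) := by
          nlinarith [sq_nonneg (|χ y| * ‖fderiv ℝ w y‖ - |w y| * ‖fderiv ℝ χ y‖)]
      _ = 2 * (χ y ^ 2 * ‖fderiv ℝ w y‖ ^ 2) + 2 * (u y ^ p * ‖fderiv ℝ χ y‖ ^ 2) := by rw [sq_abs, hw2]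
  -- the cutoff gradient is supported in the ball and bounded by `C₁/(R-r)`
  have hcut : ∀ y, u y ^ p * ‖fderiv ℝ χ y‖ ^ 2 ≤ (C₁ / (R - r)) ^ 2 * (ball x₀ R).indicator (fun y => u y ^ p) y := by
    intro y
    by_cases hy : y ∈ ball x₀ R
    · rw [indicator_of_mem hy, mul_comm]
      exact mul_le_mul_of_nonneg_right (pow_le_pow_left₀ (norm_nonneg _) (hχD y) 2)
        (Real.rpow_nonneg (hupos y).le _)
    · rw [indicator_of_notMem hy, fderiv_eq_zero_of_nonneg_of_eq_zero (fun z => (hχ01 z).1) (hχ0 y hy)]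
      simp
  -- integrability
  have hχ2c : HasCompactSupport fun y => χ y ^ 2 := hχc.comp_left (g := fun s : ℝ => s ^ 2) (by simp)
  have hgc : HasCompactSupport fun y => χ y * w y := hχc.mul_right
  have hgc2 : HasCompactSupport fun y => ‖fderiv ℝ (fun y => χ y * w y) y‖ ^ 2 :=
    (hgc.fderiv (𝕜 := ℝ)).norm.comp_left (g := fun s : ℝ => s ^ 2) (by simp)
  have hIg : Integrable fun y => ‖fderiv ℝ (fun y => χ y * w y) y‖ ^ 2 :=
    ((((hχ.mul hwd).continuous_fderiv one_ne_zero).norm).pow 2).integrable_of_hasCompactSupport hgc2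
  have hc1 : HasCompactSupport fun y => χ y ^ 2 * ‖fderiv ℝ w y‖ ^ 2 := hχ2c.mul_right
  have hI1 : Integrable fun y => χ y ^ 2 * ‖fderiv ℝ w y‖ ^ 2 :=
    ((hχ.continuous.pow 2).mul (((hwd.continuous_fderiv one_ne_zero).norm).pow 2)).integrable_of_hasCompactSupport
      hc1
  have hDχc : HasCompactSupport fun y => ‖fderiv ℝ χ y‖ ^ 2 :=
    (hχc.fderiv (𝕜 := ℝ)).norm.comp_left (g := fun s : ℝ => s ^ 2) (by simp)
  have hc3 : HasCompactSupport fun y => u y ^ p * ‖fderiv ℝ χ y‖ ^ 2 := hDχc.mul_left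
  have hI3 : Integrable fun y => u y ^ p * ‖fderiv ℝ χ y‖ ^ 2 :=
    ((hupow p).mul (((hχ.continuous_fderiv one_ne_zero).norm).pow 2)).integrable_of_hasCompactSupport hc3
  have hIball : IntegrableOn (fun y => u y ^ p) (ball x₀ R) :=
    ((hupow p).continuousOn.integrableOn_compact (isCompact_closedBall x₀ R)).mono_set ball_subset_closedBall
  have hI4 : Integrable fun y => (C₁ / (R - r)) ^ 2 * (ball x₀ R).indicator (fun y => u y ^ p) y :=
    (hIball.integrable_indicator measurableSet_ball).const_mul _
  -- Caccioppoli for `w`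
  have hcacc := integral_sq_fderiv_rpow_le hsymm hlam hmeas hell hbd hu hu1 hweak hp0 hp1 hχ hχc
  have hK0 : 0 ≤ (p / (p - 1)) ^ 2 * (n * Λ / lam) := by
    have hΛ0 : 0 ≤ n * Λ := by
      rcases Nat.eq_zero_or_pos n with hn | hn
      · simp [hn]
      · exact mul_nonneg (Nat.cast_nonneg _) ((abs_nonneg _).trans (hbd 0 ⟨0, hn⟩ ⟨0, hn⟩))
    positivity
  have hint3 : ∫ y, u y ^ p * ‖fderiv ℝ χ y‖ ^ 2 ≤ (C₁ / (R - r)) ^ 2 * ∫ y in ball x₀ R, u y ^ p := by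
    calc ∫ y, u y ^ p * ‖fderiv ℝ χ y‖ ^ 2
        ≤ ∫ y, (C₁ / (R - r)) ^ 2 * (ball x₀ R).indicator (fun y => u y ^ p) y := integral_mono hI3 hI4 hcut
      _ = (C₁ / (R - r)) ^ 2 * ∫ y in ball x₀ R, u y ^ p := by
          rw [integral_const_mul, integral_indicator measurableSet_ball]
  calc ∫ y, ‖fderiv ℝ (fun y => χ y * w y) y‖ ^ 2
      ≤ ∫ y, (2 * (χ y ^ 2 * ‖fderiv ℝ w y‖ ^ 2) + 2 * (u y ^ p * ‖fderiv ℝ χ y‖ ^ 2)) :=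
        integral_mono hIg ((hI1.const_mul 2).add (hI3.const_mul 2)) hpt
    _ = 2 * (∫ y, χ y ^ 2 * ‖fderiv ℝ w y‖ ^ 2) + 2 * ∫ y, u y ^ p * ‖fderiv ℝ χ y‖ ^ 2 := by
        rw [integral_add (hI1.const_mul 2) (hI3.const_mul 2), integral_const_mul, integral_const_mul]
    _ ≤ 2 * ((p / (p - 1)) ^ 2 * (n * Λ / lam) * ∫ y, u y ^ p * ‖fderiv ℝ χ y‖ ^ 2) +
          2 * ∫ y, u y ^ p * ‖fderiv ℝ χ y‖ ^ 2 := by linarith [hcacc]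
    _ = 2 * ((p / (p - 1)) ^ 2 * (n * Λ / lam) + 1) * ∫ y, u y ^ p * ‖fderiv ℝ χ y‖ ^ 2 := by ring
    _ ≤ 2 * ((p / (p - 1)) ^ 2 * (n * Λ / lam) + 1) * ((C₁ / (R - r)) ^ 2 * ∫ y in ball x₀ R, u y ^ p) :=
        mul_le_mul_of_nonneg_left hint3 (by positivity)
    _ = 2 * ((p / (p - 1)) ^ 2 * (n * Λ / lam) + 1) * (C₁ / (R - r)) ^ 2 * ∫ y in ball x₀ R, u y ^ p := by
        ring

end Summit.NavierStokesRegularity.NavierStokesRegularity.Theorems.PoloidalWindowDoorPoloidalWindowRigidityDivFormCutoffEnergy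

end
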